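import Summits.Ventures.DiscreteObjects.Hadamard.HadamardSignedAutParity
import Summits.Ventures.DiscreteObjects.Hadamard.SignedCycleClassCount
import Summits.Ventures.DiscreteObjects.Hadamard.CyclotomicFactorRoots
import Summits.Ventures.DiscreteObjects.Hadamard.Order4Nega4q
import Summits.Ventures.DiscreteObjects.Hadamard.AutomorphismTransfer668B

/-!
# Automorphisms of order `2p` with fixed-point-free `p`-th power of a Hadamard matrix of order `4q`: the number of `2p`-cycles is even (kernel)

Framing: lottery ticket; floor = certified bounds/negative ranges.

Cell pub-namedobj (venture DiscreteObjects), target (H), hadamard gen 15.  First cycle-level consequence of the even-multiplicity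
theorem (`HadamardSignedAutParity`, Lander's method mod `q`):

**`hadamard4q_aut_order2p_fpf`.**  Let `H` be a Hadamard matrix of order `4q`, `q ≡ 3 (mod 4)` prime, `p` a prime
`≠ q` such that `q^j ≡ -1 (mod 4p)` for some `j` (the irreducible factors of `Φ_{4p}` over `𝔽_q` are then self-reciprocal),
and `(π, κ, d, e)` a signed automorphism with `π^{2p} = κ^{2p} = 1` and `π^p`, `κ^p` fixed-point-free.  Then
`4p ∣ #{j : κ² j ≠ j}` and `4p ∣ #{i : π² i ≠ i}`: the permutation parts consist of `2`-cycles and an EVEN number of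
`2p`-cycles (and then an even number of `2`-cycles, as `4 ∣ 4q − 4p·r`).
Proof: the `p`-th power is a fixed-point-free involution, hence nega (`fpf_involution_nega_general`, gen 13), so every
`2p`-cycle has sign product `−1` and characteristic block `X^{2p} + 1 = Φ₄ Φ_{4p}`; an irreducible `h ∣ Φ_{4p}` has even
multiplicity (main theorem), lives only on the `2p`-cycles (`CyclotomicFactorRoots` + vanishing), and each `2p`-cycle carries it
once (`cycleClass_count`).
Instances: `p = 3` re-derives the order-6 theorem of gen 14 (`q ≡ 11 mod 12`) by a different route, and `p = 2` (allowed: the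
proof never uses `p` odd) re-derives the order-4 exclusion of gen 13 (`q ≡ 7 mod 8`: `8 ∣ 4q` is absurd,
`hadamard4q_no_aut_order4_fpf_sq'`); NEW at `668 = 4·167`:
`p = 7` (`167 ≡ −1 mod 28`) and `p = 11` (`167⁵ ≡ −1 mod 44`) — **orders 14 and 22**: `28 ∣ #{j : κ² j ≠ j}`, resp.
`44 ∣ #{j : κ² j ≠ j}`; at `892 = 4·223`: `p = 7`; at `716 = 4·179`: `p = 5, 13`.  Ours; no `sorry`.
-/

open Polynomial Finset BigOperators Matrix

namespace Summit.Ventures.DiscreteObjects.Hadamard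

open Literature.Combinatorics.Designs.GoethalsSeidel (IsHadamardMatrix)

variable {ι : Type*} [Fintype ι] [DecidableEq ι]

section tools

/-- a product of `±1` values is `±1` -/
lemma prod_range_pm {f : ℕ → ℤ} (hf : ∀ t, f t = 1 ∨ f t = -1) (k : ℕ) :
    ∏ t ∈ range k, f t = 1 ∨ ∏ t ∈ range k, f t = -1 := by
  induction k with
  | zero => left; simp
  | succ k ih =>
    rw [Finset.prod_range_succ]
    rcases ih with h | h <;> rcases hf k with h' | h' <;> simp [h, h']

omit [Fintype ι] [DecidableEq ι] in
/-- entries along powers of a signed automorphism: `H (π^k i) (κ^k j) = (∏_{t<k} d(π^t i)) (∏_{t<k} e(κ^t j)) H i j` -/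
theorem signedAut_pow_apply_prod {H : Matrix ι ι ℤ} {π κ : Equiv.Perm ι} {d e : ι → ℤ} (hA : IsSignedAut H π κ d e)
    (k : ℕ) (i j : ι) :
    H ((π ^ k) i) ((κ ^ k) j) = (∏ t ∈ range k, d ((π ^ t) i)) * (∏ t ∈ range k, e ((κ ^ t) j)) * H i j := by
  have hH := hA.2.2
  induction k generalizing i j with
  | zero => simp
  | succ k ih =>
    rw [pow_succ, pow_succ, Equiv.Perm.mul_apply, Equiv.Perm.mul_apply, ih (π i) (κ j), hH i j,
      Finset.prod_range_succ' (fun t => d ((π ^ t) i)), Finset.prod_range_succ' (fun t => e ((κ ^ t) j))]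
    simp only [pow_zero, Equiv.Perm.one_apply, pow_succ, Equiv.Perm.mul_apply]
    ring

omit [Fintype ι] [DecidableEq ι] in
/-- **powers of a signed automorphism** are signed automorphisms, with product signs -/
theorem isSignedAut_pow_prod {H : Matrix ι ι ℤ} {π κ : Equiv.Perm ι} {d e : ι → ℤ} (hA : IsSignedAut H π κ d e)
    (k : ℕ) :
    IsSignedAut H (π ^ k) (κ ^ k) (fun i => ∏ t ∈ range k, d ((π ^ t) i)) (fun j => ∏ t ∈ range k, e ((κ ^ t) j)) :=
  ⟨fun i => prod_range_pm (fun t => hA.1 ((π ^ t) i)) k, fun j => prod_range_pm (fun t => hA.2.1 ((κ ^ t) j)) k,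
    fun i j => signedAut_pow_apply_prod hA k i j⟩

omit [Fintype ι] [DecidableEq ι] in
/-- the sign over `2p` steps = (sign over `p` steps at `j`) · (sign over `p` steps at `κ^p j`) -/
lemma prod_range_two_mul_eq (e : ι → ℤ) (κ : Equiv.Perm ι) (p : ℕ) (j : ι) :
    ∏ t ∈ range (2 * p), e ((κ ^ t) j) = (∏ t ∈ range p, e ((κ ^ t) j)) * ∏ t ∈ range p, e ((κ ^ t) ((κ ^ p) j)) := by
  rw [two_mul, Finset.prod_range_add]
  congr 1
  refine Finset.prod_congr rfl fun t _ => ?_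
  rw [← Equiv.Perm.mul_apply, ← pow_add, add_comm]

omit [Fintype ι] [DecidableEq ι] in
/-- no short returns on a `2p`-cycle: `κ^{2p} j = j`, `κ^p j ≠ j`, `κ² j ≠ j`, `p` prime ⇒ `κ^t j ≠ j` for `0 < t < 2p` -/
lemma no_short_return_two_mul_prime {κ : Equiv.Perm ι} {p : ℕ} (hp : p.Prime) {j : ι}
    (h2p : (κ ^ (2 * p)) j = j) (hpf : (κ ^ p) j ≠ j) (h2 : (κ ^ 2) j ≠ j) {t : ℕ} (ht0 : 0 < t) (ht : t < 2 * p) :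
    (κ ^ t) j ≠ j := by
  intro hfix
  set g := Nat.gcd t (2 * p) with hgdef
  have hg : (κ ^ g) j = j := by
    have h1 : Function.IsPeriodicPt κ t j := by
      rw [Function.IsPeriodicPt, Function.IsFixedPt, Equiv.Perm.iterate_eq_pow]
      exact hfix
    have h2' : Function.IsPeriodicPt κ (2 * p) j := by
      rw [Function.IsPeriodicPt, Function.IsFixedPt, Equiv.Perm.iterate_eq_pow]
      exact h2p
    have h3 := h1.gcd h2'
    rw [Function.IsPeriodicPt, Function.IsFixedPt, Equiv.Perm.iterate_eq_pow] at h3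
    exact h3
  have hgdvd : g ∣ 2 * p := Nat.gcd_dvd_right _ _
  have hgle : g ≤ t := Nat.gcd_le_left _ ht0
  by_cases hpg : p ∣ g
  · obtain ⟨c, hc⟩ := hpg
    have hc2 : c ∣ 2 := by
      have : p * c ∣ p * 2 := by rw [← hc, mul_comm p 2]; exact hgdvd
      exact Nat.dvd_of_mul_dvd_mul_left hp.pos this
    rcases (Nat.dvd_prime Nat.prime_two).mp hc2 with rfl | rfl
    · rw [mul_one] at hc
      rw [hc] at hg
      exact hpf hg
    · omega
  · have hcop : Nat.Coprime g p := ((Nat.Prime.coprime_iff_not_dvd hp).mpr hpg).symm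
    have hg2 : g ∣ 2 := hcop.dvd_of_dvd_mul_right hgdvd
    rcases (Nat.dvd_prime Nat.prime_two).mp hg2 with h1 | h1
    · rw [h1, pow_one] at hg
      apply h2
      rw [pow_two, Equiv.Perm.mul_apply, hg, hg]
    · rw [h1] at hg
      exact h2 hg

end tools

section main

/-- **Columns.**  H(4q), `q ≡ 3 (mod 4)` prime, `p` prime `≠ q` with `q^j ≡ −1 (mod 4p)`: a signed automorphism with
`κ^{2p} = 1`, `κ^p` and `π^p` fixed-point-free (`π^{2p} = 1`) has `4p ∣ #{j : κ² j ≠ j}`. -/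
theorem hadamard4q_aut_order2p_fpf_col {q p j₀ : ℕ} (hq : q.Prime) (hq4 : q % 4 = 3) (hp : p.Prime)
    (hpq : p ≠ q) (hj : q ^ j₀ % (4 * p) = 4 * p - 1) {H : Matrix ι ι ℤ} (hH : IsHadamardMatrix H)
    (hι : Fintype.card ι = 4 * q) {π κ : Equiv.Perm ι} {d e : ι → ℤ} (haut : IsSignedAut H π κ d e)
    (hπ : ∀ i, (π ^ (2 * p)) i = i) (hκ : ∀ j, (κ ^ (2 * p)) j = j)
    (hπf : ∀ i, (π ^ p) i ≠ i) (hκf : ∀ j, (κ ^ p) j ≠ j) :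
    4 * p ∣ (univ.filter (fun j => (κ ^ 2) j ≠ j)).card := by
  haveI : Fact q.Prime := ⟨hq⟩
  have he := haut.2.1
  have hp0 : 0 < p := hp.pos
  have hp2' : 2 ≤ p := hp.two_le
  have hq2' : q ≠ 2 := by
    intro h
    rw [h] at hq4
    norm_num at hq4
  -- nonvanishing in ZMod q
  have h2q : (2 : ZMod q) ≠ 0 := by
    intro h0
    have : ((2 : ℕ) : ZMod q) = 0 := by exact_mod_cast h0
    rw [ZMod.natCast_eq_zero_iff] at this
    exact hq2' ((Nat.prime_dvd_prime_iff_eq hq Nat.prime_two).mp this)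
  have hpq' : (p : ZMod q) ≠ 0 := by
    rw [Ne, ZMod.natCast_eq_zero_iff]
    intro h
    exact hpq ((Nat.prime_dvd_prime_iff_eq hq hp).mp h).symm
  have h4p : ((4 * p : ℕ) : ZMod q) ≠ 0 := by
    push_cast
    have h4 : (4 : ZMod q) ≠ 0 := by
      rw [show (4 : ZMod q) = 2 * 2 by norm_num]
      exact mul_ne_zero h2q h2q
    exact mul_ne_zero h4 hpq'
  have h22p : ((2 * (2 * p) : ℕ) : ZMod q) ≠ 0 := by
    rw [show 2 * (2 * p) = 4 * p by ring]
    exact h4p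
  -- Hadamard data
  have hcardι : (Fintype.card ι : ℤ) ≠ 0 := by rw [hι]; push_cast; have := hq.pos; positivity
  have hHn : H * Hᵀ = ((4 * q : ℕ) : ℤ) • (1 : Matrix ι ι ℤ) := by rw [hH.2, hι]
  have hqn : (q : ℤ) ∣ ((4 * q : ℕ) : ℤ) := ⟨4, by push_cast; ring⟩
  have hqn2 : ¬ (q : ℤ) ^ 2 ∣ ((4 * q : ℕ) : ℤ) := by
    rintro ⟨c, hc⟩
    push_cast at hc
    have hq0 : (q : ℤ) ≠ 0 := by exact_mod_cast hq.ne_zero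
    have h4 : (4 : ℤ) = q * c := by
      apply mul_left_cancel₀ hq0
      linear_combination hc
    have hdvd : (q : ℤ) ∣ ((4 : ℕ) : ℤ) := ⟨c, by exact_mod_cast h4⟩
    have hdvd' : q ∣ 2 ^ 2 := by norm_num; exact_mod_cast hdvd
    exact hq2' ((Nat.prime_dvd_prime_iff_eq hq Nat.prime_two).mp (hq.dvd_of_dvd_pow hdvd'))
  -- the p-th power is a fixed-point-free involution, hence nega
  have hmod : Fintype.card ι % 8 = 4 := by rw [hι]; omega
  have hns : ¬ ∃ x y : ℕ, Fintype.card ι = x ^ 2 + y ^ 2 := by rw [hι]; exact not_sq_add_sq_four_mul_nat hq4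
  have hautp := isSignedAut_pow_prod haut p
  have hπinv : ∀ i, (π ^ p) ((π ^ p) i) = i := fun i => by
    rw [← Equiv.Perm.mul_apply, ← pow_add, ← two_mul, hπ]
  have hκinv : ∀ j, (κ ^ p) ((κ ^ p) j) = j := fun j => by
    rw [← Equiv.Perm.mul_apply, ← pow_add, ← two_mul, hκ]
  obtain ⟨-, hcol⟩ := fpf_involution_nega_general hH hmod hns hautp hπinv hκinv hπf hκf
  have hsign : ∀ j, ∏ t ∈ range (2 * p), ((e ((κ ^ t) j) : ℤ) : ZMod q) = -1 := by
    intro j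
    have e1 := prod_range_two_mul_eq e κ p j
    have hc := hcol j
    rw [hc] at e1
    have hA := pm_mul_self (prod_range_pm (fun t => he ((κ ^ t) j)) p)
    have e2 : ∏ t ∈ range (2 * p), e ((κ ^ t) j) = -1 := by
      rw [e1]
      linear_combination (-1 : ℤ) * hA
    have e3 := congrArg (Int.cast : ℤ → ZMod q) e2
    push_cast at e3
    exact e3
  -- the pull-back, the factor h ∣ Φ_{4p}, the main theorem
  have hee : ∀ j, (fun j => ((e j : ℤ) : ZMod q)) j * (fun j => ((e j : ℤ) : ZMod q)) j = 1 :=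
    signedAut_sign_sq haut q
  set Kt : Matrix ι ι (ZMod q) := Matrix.of fun j k => if k = κ j then ((e j : ℤ) : ZMod q) else 0 with hKt
  obtain ⟨h, hirr, hdvdΦ, hdvdX, hdeg⟩ :=
    exists_irreducible_factor_cyclotomic (F := ZMod q) (m := 4 * p) (by omega)
  have hmain := hadamard_signedAut_even_multiplicity H hHn hqn hqn2 haut Kt hKt (M := 2 * p) (by omega) hκ h22p
    (m := 4 * p) (j := j₀) (dvd_of_eq (by ring)) hj hirr hdvdX
  -- the class of 2p-cycles
  set S : Finset ι := univ.filter (fun j => (κ ^ 2) j ≠ j) with hS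
  have hSκ : ∀ j, κ j ∈ S ↔ j ∈ S := by
    intro j
    simp only [hS, mem_filter, mem_univ, true_and]
    rw [show (κ ^ 2) (κ j) = κ ((κ ^ 2) j) by simp [pow_two]]
    exact not_congr κ.injective.eq_iff
  have hper : ∀ j ∈ S, (κ ^ (2 * p)) j = j := fun j _ => hκ j
  have hmin : ∀ j ∈ S, ∀ t, 0 < t → t < 2 * p → (κ ^ t) j ≠ j := fun j hj t ht0 ht =>
    no_short_return_two_mul_prime hp (hκ j) (hκf j) (mem_filter.mp hj).2 ht0 ht
  have hε : ∀ j ∈ S, ∏ i ∈ range (2 * p), (fun j => ((e j : ℤ) : ZMod q)) ((κ ^ i) j) = -1 := fun j _ => hsign j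
  -- h · g = X^{2p} + 1, coprime
  have hdvd2p : h ∣ X ^ (2 * p) + 1 := by
    rw [cyclotomic_factor_dvd_X_pow_add_one_iff h4p h2q hirr hdvdΦ]
    exact ⟨dvd_of_eq (by ring), Nat.not_dvd_of_pos_of_lt (by omega) (by omega)⟩
  obtain ⟨g, hg⟩ := hdvd2p
  have hhg : h * g = X ^ (2 * p) - C (-1 : ZMod q) := by rw [X_pow_sub_C_neg_one]; exact hg.symm
  have hcop : IsCoprime h g := by
    have hsep : (X ^ (2 * (2 * p)) - 1 : (ZMod q)[X]).Separable := by
      have := separable_X_pow_sub_C (1 : ZMod q) h22p one_ne_zero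
      simpa using this
    have hdvd' : X ^ (2 * p) + 1 ∣ (X ^ (2 * (2 * p)) - 1 : (ZMod q)[X]) :=
      ⟨X ^ (2 * p) - 1, by ring⟩
    have hsep2 := hsep.of_dvd hdvd'
    rw [hg] at hsep2
    exact hsep2.isCoprime
  have hcount := cycleClass_count κ (fun j => ((e j : ℤ) : ZMod q)) Kt hee hKt S hSκ (L := 2 * p) (by omega) hper
    hmin hε hhg hcop
  -- the 2-cycles carry no h
  have hL2 : ∀ j ∈ univ \ S, (κ ^ 2) j = j := by
    intro j hj
    have := (mem_sdiff.mp hj).2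
    rw [hS, mem_filter, not_and] at this
    exact not_not.mp (this (mem_univ j))
  have hcop2 : ∀ j ∈ univ \ S,
      IsCoprime h (X ^ 2 - C (∏ i ∈ range 2, (fun j => ((e j : ℤ) : ZMod q)) ((κ ^ i) j))) := by
    intro j _
    have hcast : ∏ i ∈ range 2, (fun j => ((e j : ℤ) : ZMod q)) ((κ ^ i) j) =
        ((∏ i ∈ range 2, e ((κ ^ i) j) : ℤ) : ZMod q) := by rw [Int.cast_prod]
    rw [hcast, Irreducible.coprime_iff_not_dvd hirr]
    rcases prod_range_pm (fun t => he ((κ ^ t) j)) 2 with h1 | h1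
    · rw [h1, Int.cast_one, C_1, cyclotomic_factor_dvd_X_pow_sub_one_iff h4p hirr hdvdΦ]
      exact Nat.not_dvd_of_pos_of_lt (by omega) (by omega)
    · rw [h1, Int.cast_neg, Int.cast_one, X_pow_sub_C_neg_one, cyclotomic_factor_dvd_X_pow_add_one_iff h4p h2q hirr hdvdΦ,
        not_and_or]
      left
      exact Nat.not_dvd_of_pos_of_lt (by omega) (by omega)
  have hvan := ker_inf_supp_eq_bot_of_isCoprime κ (fun j => ((e j : ℤ) : ZMod q)) Kt hee hKt (S := univ \ S)
    (fun _ => 2) hL2 hcop2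
  -- assemble the dimension
  have hsplit := finrank_ker_inf_supp_split κ (fun j => ((e j : ℤ) : ZMod q)) Kt hKt h univ S hSκ
  rw [ker_inf_supp_univ, Finset.univ_inter, hvan, finrank_bot, add_zero] at hsplit
  rw [hsplit] at hmain
  obtain ⟨r, hr⟩ := hmain
  rw [hr] at hcount
  refine ⟨r, Nat.eq_of_mul_eq_mul_left hdeg ?_⟩
  calc h.natDegree * S.card = 2 * p * (2 * h.natDegree * r) := hcount.symm
    _ = h.natDegree * (4 * p * r) := by ring

/-- **H(4q): automorphisms of order `2p` with fixed-point-free `p`-th power have an even number of `2p`-cycles, on rows and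
on columns** (`4p ∣ #{i : π² i ≠ i}`, `4p ∣ #{j : κ² j ≠ j}`), for `q ≡ 3 (mod 4)` prime, `p` a prime `≠ q` with
`q^j ≡ −1 (mod 4p)`. -/
theorem hadamard4q_aut_order2p_fpf {q p j₀ : ℕ} (hq : q.Prime) (hq4 : q % 4 = 3) (hp : p.Prime)
    (hpq : p ≠ q) (hj : q ^ j₀ % (4 * p) = 4 * p - 1) {H : Matrix ι ι ℤ} (hH : IsHadamardMatrix H)
    (hι : Fintype.card ι = 4 * q) {π κ : Equiv.Perm ι} {d e : ι → ℤ} (haut : IsSignedAut H π κ d e)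
    (hπ : ∀ i, (π ^ (2 * p)) i = i) (hκ : ∀ j, (κ ^ (2 * p)) j = j)
    (hπf : ∀ i, (π ^ p) i ≠ i) (hκf : ∀ j, (κ ^ p) j ≠ j) :
    4 * p ∣ (univ.filter (fun i => (π ^ 2) i ≠ i)).card ∧ 4 * p ∣ (univ.filter (fun j => (κ ^ 2) j ≠ j)).card := by
  have hcardι : (Fintype.card ι : ℤ) ≠ 0 := by rw [hι]; push_cast; have := hq.pos; positivity
  exact ⟨hadamard4q_aut_order2p_fpf_col hq hq4 hp hpq hj (isHadamard_transpose hH hcardι) hι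
      (isSignedAut_transpose haut) hκ hπ hκf hπf,
    hadamard4q_aut_order2p_fpf_col hq hq4 hp hpq hj hH hι haut hπ hκ hπf hκf⟩

/-- **H(668), ORDER 14**: a signed automorphism with `π¹⁴ = κ¹⁴ = 1` and `π⁷`, `κ⁷` fixed-point-free has an even number of
`14`-cycles on rows and on columns: `28 ∣ #{i : π² i ≠ i}`, `28 ∣ #{j : κ² j ≠ j}`; hence `#{j : κ² j = j} ≡ 668 ≡ 24 (mod 28)`
and, with `orbitCount_7'` (the `7`-cycles of `g²` number `84..94`), the number of `14`-cycles is `42, 44` or `46`. -/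
theorem hadamard668_aut_order14_fpf {H : Matrix ι ι ℤ} (hH : IsHadamardMatrix H) (hι : Fintype.card ι = 668)
    {π κ : Equiv.Perm ι} {d e : ι → ℤ} (haut : IsSignedAut H π κ d e)
    (hπ : ∀ i, (π ^ 14) i = i) (hκ : ∀ j, (κ ^ 14) j = j) (hπf : ∀ i, (π ^ 7) i ≠ i) (hκf : ∀ j, (κ ^ 7) j ≠ j) :
    28 ∣ (univ.filter (fun i => (π ^ 2) i ≠ i)).card ∧ 28 ∣ (univ.filter (fun j => (κ ^ 2) j ≠ j)).card :=
  hadamard4q_aut_order2p_fpf (q := 167) (p := 7) (j₀ := 1) (by norm_num) (by norm_num) (by norm_num) (by norm_num)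
    (by norm_num) hH (by rw [hι]) haut hπ hκ hπf hκf

/-- **H(668), ORDER 22**: a signed automorphism with `π²² = κ²² = 1` and `π¹¹`, `κ¹¹` fixed-point-free has an even number of
`22`-cycles on rows and on columns: `44 ∣ #{i : π² i ≠ i}`, `44 ∣ #{j : κ² j ≠ j}` (`167⁵ ≡ −1 (mod 44)`). -/
theorem hadamard668_aut_order22_fpf {H : Matrix ι ι ℤ} (hH : IsHadamardMatrix H) (hι : Fintype.card ι = 668)
    {π κ : Equiv.Perm ι} {d e : ι → ℤ} (haut : IsSignedAut H π κ d e)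
    (hπ : ∀ i, (π ^ 22) i = i) (hκ : ∀ j, (κ ^ 22) j = j) (hπf : ∀ i, (π ^ 11) i ≠ i) (hκf : ∀ j, (κ ^ 11) j ≠ j) :
    44 ∣ (univ.filter (fun i => (π ^ 2) i ≠ i)).card ∧ 44 ∣ (univ.filter (fun j => (κ ^ 2) j ≠ j)).card :=
  hadamard4q_aut_order2p_fpf (q := 167) (p := 11) (j₀ := 5) (by norm_num) (by norm_num) (by norm_num) (by norm_num)
    (by norm_num) hH (by rw [hι]) haut hπ hκ hπf hκf

/-- **H(892), ORDER 14** (`q = 223 ≡ −1 (mod 28)`): even number of `14`-cycles for automorphisms with `g¹⁴ = 1`, `g⁷`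
fixed-point-free. -/
theorem hadamard892_aut_order14_fpf {H : Matrix ι ι ℤ} (hH : IsHadamardMatrix H) (hι : Fintype.card ι = 892)
    {π κ : Equiv.Perm ι} {d e : ι → ℤ} (haut : IsSignedAut H π κ d e)
    (hπ : ∀ i, (π ^ 14) i = i) (hκ : ∀ j, (κ ^ 14) j = j) (hπf : ∀ i, (π ^ 7) i ≠ i) (hκf : ∀ j, (κ ^ 7) j ≠ j) :
    28 ∣ (univ.filter (fun i => (π ^ 2) i ≠ i)).card ∧ 28 ∣ (univ.filter (fun j => (κ ^ 2) j ≠ j)).card :=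
  hadamard4q_aut_order2p_fpf (q := 223) (p := 7) (j₀ := 1) (by norm_num) (by norm_num) (by norm_num) (by norm_num)
    (by norm_num) hH (by rw [hι]) haut hπ hκ hπf hκf

/-- **H(716), ORDER 10** (`q = 179 ≡ −1 (mod 20)`): even number of `10`-cycles for automorphisms with `g¹⁰ = 1`, `g⁵`
fixed-point-free: `20 ∣ #{i : π² i ≠ i}`, `20 ∣ #{j : κ² j ≠ j}`. -/
theorem hadamard716_aut_order10_fpf {H : Matrix ι ι ℤ} (hH : IsHadamardMatrix H) (hι : Fintype.card ι = 716)
    {π κ : Equiv.Perm ι} {d e : ι → ℤ} (haut : IsSignedAut H π κ d e)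
    (hπ : ∀ i, (π ^ 10) i = i) (hκ : ∀ j, (κ ^ 10) j = j) (hπf : ∀ i, (π ^ 5) i ≠ i) (hκf : ∀ j, (κ ^ 5) j ≠ j) :
    20 ∣ (univ.filter (fun i => (π ^ 2) i ≠ i)).card ∧ 20 ∣ (univ.filter (fun j => (κ ^ 2) j ≠ j)).card :=
  hadamard4q_aut_order2p_fpf (q := 179) (p := 5) (j₀ := 1) (by norm_num) (by norm_num) (by norm_num) (by norm_num)
    (by norm_num) hH (by rw [hι]) haut hπ hκ hπf hκf

/-- **`p = 2` re-derives the order-4 exclusion of gen 13**: for `q ≡ 7 (mod 8)` prime (`q ≡ −1 (mod 8)`) no Hadamard matrix of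
order `4q` has a signed automorphism with `π⁴ = κ⁴ = 1` and `π²`, `κ²` fixed-point-free (then every column lies on a
`4`-cycle, and `8 ∣ 4q` is false). -/
theorem hadamard4q_no_aut_order4_fpf_sq' {q : ℕ} (hq : q.Prime) (hq8 : q % 8 = 7) {H : Matrix ι ι ℤ}
    (hH : IsHadamardMatrix H) (hι : Fintype.card ι = 4 * q) {π κ : Equiv.Perm ι} {d e : ι → ℤ}
    (haut : IsSignedAut H π κ d e) (hπ : ∀ i, (π ^ 4) i = i) (hκ : ∀ j, (κ ^ 4) j = j)
    (hπf : ∀ i, (π ^ 2) i ≠ i) (hκf : ∀ j, (κ ^ 2) j ≠ j) : False := by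
  have hq2 : (2 : ℕ) ≠ q := by intro h; rw [← h] at hq8; norm_num at hq8
  have h := hadamard4q_aut_order2p_fpf_col (p := 2) (j₀ := 1) hq (by omega) Nat.prime_two hq2
    (by rw [pow_one]; omega) hH hι haut hπ hκ hπf hκf
  rw [Finset.filter_true_of_mem (fun j _ => hκf j), Finset.card_univ, hι] at h
  have : (8 : ℕ) ∣ 4 * q := h
  omega

end main

end Summit.Ventures.DiscreteObjects.Hadamard
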